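import Summits.QuantumAdvantage.QuantumAdvantage.Theorems.RankDialL5
import HarnessLib

/-!
# RankDial (L6) — §36–§38 THE ANALYTIC ENGINE OF A BLOCK LAW: VW with partial gain, label phases, label characters as gap-constant forms

TARGET BY NAME (cell decomp-qadv, RESIDUAL MODE): item stmt-QuantumAdvantage-23109
`Summit.QuantumAdvantage.QuantumAdvantage.Theses.OddPrimeWalk.ManyReadersSqrtOdd`, through rung R5 = `AdviceFreeQNC0.WalkHardFLinSel p`.
This file SUPPORTS the item (`--supports`); it does not close it.  Declaration bodies are byte-identical to §36–§38 of the cell node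
«BlockDial» (decomp-qadv lens-1, generation 27, part L; node file RankDialL.lean, rev 4).  §36 `vw_prod_norm_le_on` /
`vw_prod_norm_le_cube_on`: the Viola–Wigderson product-norm bound of part H1 with gain only on a set `A` of coordinates
(`‖Σ_v (−1)^{Q v} Π_{i:v_i} ζ_i‖ ≤ 2^ℓ·exp(−η|A|/4^{d+1})` when `Re ζ_i^{2^d} ≤ 1 − η` on `A`).  §37 the phases `ζ_i = e₃(β_i)e_p(μ_i)`
(`re_zetaBM_pow_le`: non-resonant wherever `β_i ≠ 0`, `p ≠ 3`) and `norm_twisted_label_le`: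
`‖Σ_v (−1)^{Q v} e₃(β·v) e_p(μ·v)‖ ≤ 2^ℓ·exp(−η_p·#supp β/4^{s+1})` for `Q ∈ lowDeg 𝔽₂ ℓ s`.  §38 the label characters of §31–§32 are
such forms: `labelDot t (blockLabel L h v) = labelForm (labelCoef L h t) v` with `labelCoef` constant on the gaps between inside positions,
and `le_card_labelCoef_support`: positions distinct and `≥ m` from the ends and from each other, `t ≠ 0` ⟹ `#supp ≥ m`; hence
`norm_twisted_blockLabel_le(_of_sepBlock)`: `‖Σ_v (−1)^{Q v} e₃(⟨t, blockLabel v⟩) e_p(μ·v)‖ ≤ 2^ℓ·exp(−η_p·⌊ℓ/η⌋/4^{s+1})` for every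
`t ≠ 0` on an `η`-separated block.  Imports part L5.
-/

set_option linter.dupNamespace false
set_option autoImplicit false

noncomputable section
open Classical

namespace Summit.QuantumAdvantage.QuantumAdvantage.Theorems.RankDial

open Finset
open Summit.QuantumAdvantage.AdviceFreeQNC0
open Literature.Computability.MetaComplexity Literature.Computability.MetaComplexity.Smolensky

/-! ### §36 (part L «BlockDial») VIOLA–WIGDERSON WITH PARTIAL GAIN: decay from the coordinates that carry a non-resonant phase -/

section VWPartial
variable {ℓ : ℕ}

/-- **VW with partial gain** (per-coordinate phases, gain only on a set `A` of coordinates): for `P : 𝔽₂^ℓ → 𝔽₂` of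
derivative-degree `≤ d`, unit phases `ζ_i`, and `Re ζ_i^{2^d} ≤ 1 − η` for `i ∈ A` (`η ≤ 2`; nothing assumed off `A`):
`‖Σ_z (−1)^{P z} Π_i (1,ζ_i)(z_i)‖ ≤ 2^ℓ·exp(−η·|A|/4^{d+1})`.  [`vw_prod_pow_le` of part H1 is already per-coordinate; the
factors off `A` are bounded by `1`.]  This is the engine for LABEL characters, whose phase is trivial on part of the block. -/
theorem vw_prod_norm_le_on {d : ℕ} {P : (Fin ℓ → ZMod 2) → ZMod 2} (hP : GowersCube.DegLE d P)
    (ζ : Fin ℓ → ℂ) (hζ : ∀ i, ‖ζ i‖ = 1) {η : ℝ} (hη2 : η ≤ 2) (A : Finset (Fin ℓ))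
    (hη : ∀ i ∈ A, ((ζ i) ^ 2 ^ d).re ≤ 1 - η) :
    ‖∑ z : Fin ℓ → ZMod 2, GowersCube.signChar (P z) * ∏ i, GowersCube.phaseFn (ζ i) (z i)‖ ≤
      2 ^ ℓ * Real.exp (-(η * A.card / 4 ^ (d + 1))) := by
  set S := ∑ z : Fin ℓ → ZMod 2, GowersCube.signChar (P z) * ∏ i, GowersCube.phaseFn (ζ i) (z i) with hS
  set Nm := ‖S / 2 ^ ℓ‖ with hNm
  have h := vw_prod_pow_le hP ζ hζ
  have hN : (0 : ℝ) < 2 ^ (d + 1) := by positivity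
  have h2N : (2 : ℝ) ≤ 2 ^ (d + 1) := by
    calc (2 : ℝ) = 2 ^ 1 := by norm_num
      _ ≤ 2 ^ (d + 1) := pow_le_pow_right₀ (by norm_num) (by omega)
  have hfac : ∀ i ∈ A, 1 - (1 - ((ζ i) ^ 2 ^ d).re) / 2 ^ (d + 1) ≤ 1 - η / 2 ^ (d + 1) := by
    intro i hi
    have h1 : η / 2 ^ (d + 1) ≤ (1 - ((ζ i) ^ 2 ^ d).re) / 2 ^ (d + 1) :=
      div_le_div_of_nonneg_right (by linarith [hη i hi]) hN.le
    linarith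
  have hfac1 : ∀ i, 1 - (1 - ((ζ i) ^ 2 ^ d).re) / 2 ^ (d + 1) ≤ 1 := by
    intro i
    have hre : ((ζ i) ^ 2 ^ d).re ≤ 1 := by
      have := (abs_le.1 (Complex.abs_re_le_norm ((ζ i) ^ 2 ^ d))).2
      rw [norm_pow, hζ i, one_pow] at this
      exact this
    have h0 : 0 ≤ (1 - ((ζ i) ^ 2 ^ d).re) / 2 ^ (d + 1) := div_nonneg (by linarith) hN.le
    linarith
  have hfac0 : ∀ i, 0 ≤ 1 - (1 - ((ζ i) ^ 2 ^ d).re) / 2 ^ (d + 1) := by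
    intro i
    have hre : -1 ≤ ((ζ i) ^ 2 ^ d).re := by
      have := (abs_le.1 (Complex.abs_re_le_norm ((ζ i) ^ 2 ^ d))).1
      rw [norm_pow, hζ i, one_pow] at this
      exact this
    rw [sub_nonneg, div_le_one hN]
    linarith
  have hbase0 : 0 ≤ 1 - η / 2 ^ (d + 1) := by
    rw [sub_nonneg, div_le_one hN]
    linarith
  have hbase : 1 - η / 2 ^ (d + 1) ≤ Real.exp (-(η / 2 ^ (d + 1))) := by
    have := Real.add_one_le_exp (-(η / 2 ^ (d + 1)))
    linarith
  have hprod : ∏ i, (1 - (1 - ((ζ i) ^ 2 ^ d).re) / 2 ^ (d + 1)) ≤ (1 - η / 2 ^ (d + 1)) ^ A.card := by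
    calc ∏ i, (1 - (1 - ((ζ i) ^ 2 ^ d).re) / 2 ^ (d + 1))
        ≤ ∏ i, (if i ∈ A then (1 - η / 2 ^ (d + 1)) else 1) :=
          Finset.prod_le_prod (fun i _ => hfac0 i) (fun i _ => by
            split_ifs with hi
            · exact hfac i hi
            · exact hfac1 i)
      _ = (1 - η / 2 ^ (d + 1)) ^ A.card := by
          rw [Finset.prod_ite_mem, Finset.univ_inter, Finset.prod_const]
  have h2 : Nm ^ 2 ^ (d + 1) ≤ Real.exp (-(η * A.card / 4 ^ (d + 1))) ^ 2 ^ (d + 1) := by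
    calc Nm ^ 2 ^ (d + 1) ≤ (1 - η / 2 ^ (d + 1)) ^ A.card := le_trans h hprod
      _ ≤ Real.exp (-(η / 2 ^ (d + 1))) ^ A.card := pow_le_pow_left₀ hbase0 hbase _
      _ = Real.exp (-(η * A.card / 4 ^ (d + 1))) ^ 2 ^ (d + 1) := by
          rw [← Real.exp_nat_mul, ← Real.exp_nat_mul]
          congr 1
          have h4 : (4 : ℝ) ^ (d + 1) = 2 ^ (d + 1) * 2 ^ (d + 1) := by
            rw [← mul_pow]; norm_num
          rw [h4]
          field_simp
          push_cast
          ring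
  have hle : Nm ≤ Real.exp (-(η * A.card / 4 ^ (d + 1))) :=
    (pow_le_pow_iff_left₀ (norm_nonneg _) (Real.exp_nonneg _) (pow_ne_zero _ two_ne_zero)).1 h2
  have hSN : ‖S‖ = 2 ^ ℓ * Nm := by
    rw [hNm, norm_div, norm_pow, Complex.norm_ofNat]
    field_simp
  rw [hSN]
  exact mul_le_mul_of_nonneg_left hle (by positivity)

/-- **VW with partial gain, on the tree's cube `{0,1}^ℓ`**: for `Q ∈ lowDeg 𝔽₂ ℓ d`, unit phases `ζ_i` with `Re ζ_i^{2^d} ≤ 1 − η` on `A`: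
`‖Σ_v (−1)^{Q v} Π_{i : v_i} ζ_i‖ ≤ 2^ℓ·exp(−η·|A|/4^{d+1})`. -/
theorem vw_prod_norm_le_cube_on {d : ℕ} {Q : CubeFn (ZMod 2) ℓ} (hQ : Q ∈ lowDeg (ZMod 2) ℓ d)
    (ζ : Fin ℓ → ℂ) (hζ : ∀ i, ‖ζ i‖ = 1) {η : ℝ} (hη2 : η ≤ 2) (A : Finset (Fin ℓ))
    (hη : ∀ i ∈ A, ((ζ i) ^ 2 ^ d).re ≤ 1 - η) :
    ‖∑ v : Fin ℓ → Bool, GowersCube.signChar (Q v) * ∏ i, (if v i = true then ζ i else 1)‖ ≤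
      2 ^ ℓ * Real.exp (-(η * A.card / 4 ^ (d + 1))) := by
  have h := vw_prod_norm_le_on (GowersCube.degLE_of_mem_lowDeg hQ) ζ hζ hη2 A hη
  have hsum : (∑ v : Fin ℓ → Bool, GowersCube.signChar (Q v) * ∏ i, (if v i = true then ζ i else 1)) =
      ∑ z : Fin ℓ → ZMod 2, GowersCube.signChar (Q (GowersCube.cubeOf z)) *
        ∏ i, GowersCube.phaseFn (ζ i) (z i) := by
    refine Fintype.sum_equiv GowersCube.cubeEquiv _ _ fun v => ?_
    have hv : GowersCube.cubeOf (GowersCube.cubeEquiv v) = v := GowersCube.cubeEquiv.left_inv v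
    rw [hv]
    congr 1
    refine Finset.prod_congr rfl fun i _ => ?_
    cases h : v i <;> simp [GowersCube.cubeEquiv, GowersCube.bit, GowersCube.phaseFn, h]
  rw [hsum]
  exact h

end VWPartial

/-! ### §37 (part L «BlockDial») THE PHASES `e₃(β_i)·e_p(μ_i)` AND THE TWISTED LABEL-CHARACTER BOUND -/

section LabelPhase
variable {p : ℕ} [Fact p.Prime] {ℓ : ℕ}

omit [Fact p.Prime] in
/-- A `ℤ₃`-linear form of the block content: `Σ_{i : v_i} β_i`. -/
def labelForm (β : Fin ℓ → ZMod 3) (v : Fin ℓ → Bool) : ZMod 3 := ∑ i, if v i then β i else 0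

/-- The phase of coordinate `i` for a label character twisted by a `ℤ_p`-character: `ζ_i = e₃(β_i)·e_p(μ_i)`. -/
def zetaBM (β : Fin ℓ → ZMod 3) (μ : Fin ℓ → ZMod p) (i : Fin ℓ) : ℂ :=
  (ZMod.stdAddChar (β i) : ℂ) * ZMod.stdAddChar (μ i)

/-- `‖ζ_i‖ = 1`. -/
theorem norm_zetaBM (β : Fin ℓ → ZMod 3) (μ : Fin ℓ → ZMod p) (i : Fin ℓ) : ‖zetaBM β μ i‖ = 1 := by
  rw [zetaBM, norm_mul, AddChar.norm_apply, AddChar.norm_apply, one_mul]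

/-- `ζ_i = e^{2πi(p·β_i + 3·μ_i)/(3p)}`. -/
theorem zetaBM_eq_exp (β : Fin ℓ → ZMod 3) (μ : Fin ℓ → ZMod p) (i : Fin ℓ) :
    zetaBM β μ i = Complex.exp (2 * Real.pi * Complex.I * ((p * (β i).val + 3 * (μ i).val : ℕ) : ℂ) / (3 * p : ℕ)) := by
  have hp0 : (p : ℂ) ≠ 0 := by exact_mod_cast (Fact.out : p.Prime).ne_zero
  rw [zetaBM, ← TwoModuli.exp_val_eq_stdAddChar (β i), ← TwoModuli.exp_val_eq_stdAddChar (μ i), ← Complex.exp_add]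
  congr 1
  push_cast
  field_simp

/-- **`Re ζ_i^{2^d} ≤ 1 − η_p` whenever `β_i ≠ 0`** (`p ≠ 3`; the power is `e^{2πiK/(3p)}` with `K = 2^d(p·β_i + 3μ_i)`, `3 ∤ K`). -/
theorem re_zetaBM_pow_le (hp3 : p ≠ 3) (β : Fin ℓ → ZMod 3) (μ : Fin ℓ → ZMod p) (i : Fin ℓ) (hβ : β i ≠ 0) (d : ℕ) :
    ((zetaBM β μ i) ^ 2 ^ d).re ≤ 1 - etaP p := by
  have hpp : p.Prime := Fact.out
  have hb : (β i).val ≠ 0 := fun h0 => hβ ((ZMod.val_eq_zero (β i)).mp h0)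
  have hb3 : (β i).val < 3 := ZMod.val_lt (β i)
  have hK : ¬ 3 * p ∣ 2 ^ d * (p * (β i).val + 3 * (μ i).val) := by
    intro hd
    have h3 : 3 ∣ 2 ^ d * (p * (β i).val + 3 * (μ i).val) := dvd_trans (Dvd.intro p rfl) hd
    rcases (Nat.Prime.dvd_mul Nat.prime_three).1 h3 with h2 | h2
    · have := Nat.Prime.dvd_of_dvd_pow Nat.prime_three h2
      omega
    · have hpb : 3 ∣ p * (β i).val := (Nat.dvd_add_left (Dvd.intro _ rfl)).1 h2
      rcases (Nat.Prime.dvd_mul Nat.prime_three).1 hpb with h4 | h4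
      · exact hp3 ((Nat.prime_dvd_prime_iff_eq Nat.prime_three hpp).1 h4).symm
      · omega
  have hpow : (zetaBM β μ i) ^ 2 ^ d =
      Complex.exp (2 * Real.pi * Complex.I * ((2 ^ d * (p * (β i).val + 3 * (μ i).val) : ℕ) : ℂ) / (3 * p : ℕ)) := by
    rw [zetaBM_eq_exp, ← Complex.exp_nat_mul]
    congr 1
    push_cast
    ring
  rw [hpow]
  exact re_exp_le_of_not_dvd hK

/-- `e₃(labelForm β v)·e_p(linPart μ v) = Π_{i : v_i} ζ_i` (separation of variables). -/
theorem stdAddChar_labelForm_mul_linPart (β : Fin ℓ → ZMod 3) (μ : Fin ℓ → ZMod p) (v : Fin ℓ → Bool) :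
    (ZMod.stdAddChar (labelForm β v) : ℂ) * ZMod.stdAddChar (linPart μ v) = ∏ i, (if v i = true then zetaBM β μ i else 1) := by
  rw [labelForm, linPart, TwoModuli.stdAddChar_sum_ite, TwoModuli.stdAddChar_sum_ite, ← Finset.prod_mul_distrib]
  refine Finset.prod_congr rfl fun i _ => ?_
  unfold zetaBM
  split_ifs <;> simp

/-- **THE TWISTED LABEL-CHARACTER BOUND** (`p ≠ 3`): for `Q ∈ lowDeg 𝔽₂ ℓ s`, `β ∈ ℤ₃^ℓ`, `μ ∈ ℤ_p^ℓ`: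
`‖Σ_v (−1)^{Q v}·e₃(β·v)·e_p(μ·v)‖ ≤ 2^ℓ·exp(−η_p·#{i : β_i ≠ 0}/4^{s+1})` — decay from the support of `β` only
(`norm_twisted_narrow_le` of part H1 is the case `β ≡ 1`). -/
theorem norm_twisted_label_le (hp3 : p ≠ 3) {s : ℕ} {Q : CubeFn (ZMod 2) ℓ} (hQ : Q ∈ lowDeg (ZMod 2) ℓ s)
    (β : Fin ℓ → ZMod 3) (μ : Fin ℓ → ZMod p) :
    ‖∑ v : Fin ℓ → Bool, GowersCube.signChar (Q v) * ((ZMod.stdAddChar (labelForm β v) : ℂ) * ZMod.stdAddChar (linPart μ v))‖ ≤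
      2 ^ ℓ * Real.exp (-(etaP p * (univ.filter fun i => β i ≠ 0).card / 4 ^ (s + 1))) := by
  have h := vw_prod_norm_le_cube_on hQ (zetaBM β μ) (norm_zetaBM β μ) (etaP_le_two p) (univ.filter fun i => β i ≠ 0)
    (fun i hi => re_zetaBM_pow_le hp3 β μ i (Finset.mem_filter.1 hi).2 s)
  have hsum : (∑ v : Fin ℓ → Bool, GowersCube.signChar (Q v) *
      ((ZMod.stdAddChar (labelForm β v) : ℂ) * ZMod.stdAddChar (linPart μ v))) =
      ∑ v : Fin ℓ → Bool, GowersCube.signChar (Q v) * ∏ i, (if v i = true then zetaBM β μ i else 1) := by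
    refine Finset.sum_congr rfl fun v _ => ?_
    rw [stdAddChar_labelForm_mul_linPart]
  rw [hsum]
  exact h

end LabelPhase

/-! ### §38 (part L «BlockDial») LABEL CHARACTERS ARE GAP-CONSTANT LINEAR FORMS: `⟨t, label(v)⟩ = Σ_{i : v_i} c_i(t)`, support `≥` the gap -/

section LabelCoef
variable {p : ℕ} [Fact p.Prime] {ℓ : ℕ}

omit [Fact p.Prime] in
/-- The coefficient vector of the label character `t = (t₀, (t_j))` relative to inside positions `h_j` of the block `[L, L+ℓ)`:
`c_i(t) = t₀ + Σ_{j : i < h_j − L} t_j` — constant on every gap between consecutive inside positions. -/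
def labelCoef (L : ℕ) {J : ℕ} (h : Fin J → ℕ) (t : ZMod 3 × (Fin J → ZMod 3)) (i : Fin ℓ) : ZMod 3 :=
  t.1 + ∑ j, if i.val < h j - L then t.2 j else 0

omit [Fact p.Prime] in
/-- The pairing of a character index with a label: `⟨t, z⟩ = t₀ z₀ + Σ_j t_j w_j`. -/
def labelDot {J : ℕ} (t z : ZMod 3 × (Fin J → ZMod 3)) : ZMod 3 := t.1 * z.1 + ∑ j, t.2 j * z.2 j

omit [Fact p.Prime] in
/-- A window of `m` consecutive coordinates on which a predicate holds gives `m ≤ #{i : Pr i}`. -/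
theorem window_le_card_filter (Pr : Fin ℓ → Prop) [DecidablePred Pr] (M m : ℕ) (hMm : M + m ≤ ℓ)
    (hP : ∀ i : Fin ℓ, M ≤ i.val → i.val < M + m → Pr i) : m ≤ (univ.filter Pr).card := by
  let f : Fin m → Fin ℓ := fun k => ⟨M + k.val, by omega⟩
  have hf : Function.Injective f := by
    intro k k' hk
    have hv : (f k).val = (f k').val := by rw [hk]
    exact Fin.ext (by simpa [f] using hv)
  calc m = (univ.image f).card := by
        rw [Finset.card_image_of_injective _ hf, Finset.card_univ, Fintype.card_fin]
    _ ≤ (univ.filter Pr).card := by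
        refine Finset.card_le_card fun i hi => ?_
        rw [Finset.mem_image] at hi
        obtain ⟨k, -, rfl⟩ := hi
        exact Finset.mem_filter.2 ⟨Finset.mem_univ _, hP (f k) (by simp [f]) (by simp [f])⟩

omit [Fact p.Prime] in
/-- **`⟨t, blockLabel v⟩ = labelForm (labelCoef t) v`**: the label character of index `t` is the `ℤ₃`-linear form with the
gap-constant coefficient vector `c(t)`. -/
theorem labelDot_blockLabel (L : ℕ) {J : ℕ} (h : Fin J → ℕ) (t : ZMod 3 × (Fin J → ZMod 3)) (v : Fin ℓ → Bool) :
    labelDot t (blockLabel L h v) = labelForm (labelCoef L h t) v := by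
  have hwt : ((wt v : ℕ) : ZMod 3) = ∑ i, if v i = true then (1 : ZMod 3) else 0 := by
    unfold wt; rw [Finset.natCast_card_filter]
  have hwp : ∀ m : ℕ, ((wtPrefix v m : ℕ) : ZMod 3) = ∑ i : Fin ℓ, if (i.val < m ∧ v i = true) then (1 : ZMod 3) else 0 := by
    intro m; unfold wtPrefix; rw [Finset.natCast_card_filter]
  simp only [labelDot, blockLabel, labelForm, labelCoef, hwt, hwp, Finset.mul_sum]
  rw [Finset.sum_comm, ← Finset.sum_add_distrib]
  refine Finset.sum_congr rfl fun i _ => ?_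
  by_cases hv : v i = true
  · rw [if_pos hv, if_pos hv, mul_one]
    congr 1
    refine Finset.sum_congr rfl fun j _ => ?_
    by_cases hc : i.val < h j - L
    · rw [if_pos ⟨hc, hv⟩, if_pos hc, mul_one]
    · rw [if_neg (fun hh => hc hh.1), if_neg hc, mul_zero]
  · rw [if_neg hv, if_neg hv, mul_zero, zero_add]
    refine Finset.sum_eq_zero fun j _ => ?_
    rw [if_neg (fun hh => hv hh.2), mul_zero]

omit [Fact p.Prime] in
/-- **Support of a non-trivial label character** — the combinatorial heart of every block law with inside cuts.  If the inside
positions are distinct, at distance `≥ m` from both ends of the block and pairwise (`m ≤ ℓ`), then for every `t ≠ 0` the coefficient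
vector `c(t)` is non-zero on at least `m` coordinates: if `t₀ ≠ 0` the last gap reads `t₀`; otherwise the gap just before the LAST position
`h_{j*}` with `t_{j*} ≠ 0` reads `t_{j*}`. -/
theorem le_card_labelCoef_support (L m : ℕ) {J : ℕ} (h : Fin J → ℕ) (hinj : Function.Injective h)
    (hleft : ∀ j, L + m ≤ h j) (hright : ∀ j, h j + m ≤ L + ℓ) (hpair : ∀ j j', h j < h j' → h j + m ≤ h j')
    (hm : m ≤ ℓ) (t : ZMod 3 × (Fin J → ZMod 3)) (ht : t ≠ 0) :
    m ≤ (univ.filter fun i : Fin ℓ => labelCoef L h t i ≠ 0).card := by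
  by_cases h1 : t.1 ≠ 0
  · -- the last gap: every coordinate beyond all inside positions reads `t.1`
    set M := (univ : Finset (Fin J)).sup (fun j => h j - L) with hM
    have hMle : ∀ j, h j - L ≤ M := fun j => Finset.le_sup (f := fun j => h j - L) (Finset.mem_univ j)
    have hMm : M + m ≤ ℓ := by
      have hM' : M ≤ ℓ - m := Finset.sup_le fun j _ => by have := hright j; have := hleft j; omega
      omega
    refine window_le_card_filter _ M m hMm fun i hi1 _ => ?_
    have hsum : (∑ j, if i.val < h j - L then t.2 j else 0) = 0 := by
      refine Finset.sum_eq_zero fun j _ => ?_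
      have hn : ¬ i.val < h j - L := by have := hMle j; omega
      rw [if_neg hn]
    show t.1 + (∑ j, if i.val < h j - L then t.2 j else 0) ≠ 0
    rw [hsum, add_zero]
    exact h1
  · have h1' : t.1 = 0 := not_ne_iff.mp h1
    have h2 : t.2 ≠ 0 := fun h2 => ht (Prod.ext h1' h2)
    have hS : (univ.filter fun j => t.2 j ≠ 0).Nonempty := by
      by_contra hS
      rw [Finset.not_nonempty_iff_eq_empty, Finset.filter_eq_empty_iff] at hS
      exact h2 (funext fun j => by simpa using hS (Finset.mem_univ j))
    obtain ⟨js, hjs, hmax⟩ := Finset.exists_max_image _ h hS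
    have hjs2 : t.2 js ≠ 0 := (Finset.mem_filter.1 hjs).2
    have hMm : h js - L - m + m ≤ ℓ := by have := hright js; have := hleft js; omega
    refine window_le_card_filter _ (h js - L - m) m hMm fun i hi1 hi2 => ?_
    have hsum : (∑ j, if i.val < h j - L then t.2 j else 0) = t.2 js := by
      rw [Finset.sum_eq_single js]
      · have hc : i.val < h js - L := by have := hleft js; omega
        rw [if_pos hc]
      · intro j _ hj
        by_cases htj : t.2 j = 0
        · simp [htj]
        · have hle : h j ≤ h js := hmax j (Finset.mem_filter.2 ⟨Finset.mem_univ _, htj⟩)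
          have hlt : h j < h js := lt_of_le_of_ne hle (fun he => hj (hinj he))
          have hp := hpair j js hlt
          have hn : ¬ i.val < h j - L := by omega
          rw [if_neg hn]
      · intro hn
        exact absurd (Finset.mem_univ js) hn
    show t.1 + (∑ j, if i.val < h j - L then t.2 j else 0) ≠ 0
    rw [hsum, h1', zero_add]
    exact hjs2

/-- The twisted label-character bound, monotone form: support `≥ m` ⟹ decay `exp(−η_p m/4^{s+1})`. -/
theorem norm_twisted_label_le_of_support (hp3 : p ≠ 3) {s : ℕ} {Q : CubeFn (ZMod 2) ℓ} (hQ : Q ∈ lowDeg (ZMod 2) ℓ s)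
    (β : Fin ℓ → ZMod 3) (μ : Fin ℓ → ZMod p) {m : ℕ} (hm : m ≤ (univ.filter fun i => β i ≠ 0).card) :
    ‖∑ v : Fin ℓ → Bool, GowersCube.signChar (Q v) * ((ZMod.stdAddChar (labelForm β v) : ℂ) * ZMod.stdAddChar (linPart μ v))‖ ≤
      2 ^ ℓ * Real.exp (-(etaP p * m / 4 ^ (s + 1))) := by
  refine (norm_twisted_label_le hp3 hQ β μ).trans (mul_le_mul_of_nonneg_left (Real.exp_le_exp.2 ?_) (by positivity))
  have hη := etaP_pos (p := p)
  have hmr : (m : ℝ) ≤ ((univ.filter fun i => β i ≠ 0).card : ℝ) := by exact_mod_cast hm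
  have h4 : (0 : ℝ) < 4 ^ (s + 1) := by positivity
  rw [neg_le_neg_iff, div_le_div_iff_of_pos_right h4]
  exact mul_le_mul_of_nonneg_left hmr hη.le

/-- **THE BLOCK-LABEL CHARACTER-SUM BOUND** (`p ≠ 3`) — the one analytic input of a block law with inside cuts.  Inside positions
`h_j` distinct, `≥ m` from the ends and from each other, `m ≤ ℓ`; `Q ∈ lowDeg 𝔽₂ ℓ s` (the signs of the passing cuts on a level set);
`μ` any `ℤ_p`-form (a level-set character); `t ≠ 0` a label-character index.  Then
`‖Σ_v (−1)^{Q v}·e₃(⟨t, blockLabel v⟩)·e_p(μ·v)‖ ≤ 2^ℓ·exp(−η_p·m/4^{s+1})`. -/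
theorem norm_twisted_blockLabel_le (hp3 : p ≠ 3) {s : ℕ} {Q : CubeFn (ZMod 2) ℓ} (hQ : Q ∈ lowDeg (ZMod 2) ℓ s)
    (μ : Fin ℓ → ZMod p) (L m : ℕ) {J : ℕ} (h : Fin J → ℕ) (hinj : Function.Injective h)
    (hleft : ∀ j, L + m ≤ h j) (hright : ∀ j, h j + m ≤ L + ℓ) (hpair : ∀ j j', h j < h j' → h j + m ≤ h j')
    (hm : m ≤ ℓ) (t : ZMod 3 × (Fin J → ZMod 3)) (ht : t ≠ 0) :
    ‖∑ v : Fin ℓ → Bool, GowersCube.signChar (Q v) *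
        ((ZMod.stdAddChar (labelDot t (blockLabel L h v)) : ℂ) * ZMod.stdAddChar (linPart μ v))‖ ≤
      2 ^ ℓ * Real.exp (-(etaP p * m / 4 ^ (s + 1))) := by
  have hs := le_card_labelCoef_support L m h hinj hleft hright hpair hm t ht
  simp_rw [labelDot_blockLabel L h t]
  exact norm_twisted_label_le_of_support hp3 hQ (labelCoef L h t) μ hs

/-- **The separated-block case**: for an `η`-separated block and the canonical inside positions `posOf` of a set `P` of live cuts
(e.g. a pass set), every non-trivial label character has support `≥ ⌊ℓ/η⌋`. -/
theorem le_card_labelCoef_support_of_sepBlock {L R : ℕ} (y : Fin (L + ℓ + R + 1) → (Fin (L + ℓ + R) → Bool) → Bool) {η : ℕ}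
    (hsep : SepBlock y L ℓ η) (P : Finset (Fin (L + ℓ + R + 1))) (hlive : ∀ g ∈ P, Live y g)
    (t : ZMod 3 × (Fin (insideCuts L ℓ P).card → ZMod 3)) (ht : t ≠ 0) :
    ℓ / η ≤ (univ.filter fun i : Fin ℓ => labelCoef L (posOf L ℓ P) t i ≠ 0).card := by
  have hmem : ∀ j : Fin (insideCuts L ℓ P).card, L < ((insideCuts L ℓ P).orderEmbOfFin rfl j).val ∧
      ((insideCuts L ℓ P).orderEmbOfFin rfl j).val < L + ℓ ∧ Live y ((insideCuts L ℓ P).orderEmbOfFin rfl j) := by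
    intro j
    have h' := Finset.mem_filter.mp (Finset.orderEmbOfFin_mem (insideCuts L ℓ P) rfl j)
    exact ⟨h'.2.1, h'.2.2, hlive _ h'.1⟩
  refine le_card_labelCoef_support L (ℓ / η) (posOf L ℓ P) ?_ ?_ ?_ ?_ (Nat.div_le_self ℓ η) t ht
  · intro j j' hjj
    exact ((insideCuts L ℓ P).orderEmbOfFin rfl).injective (Fin.ext hjj)
  · intro j
    exact (hsep.1 _ (hmem j).1 (hmem j).2.1 (hmem j).2.2).1
  · intro j
    exact (hsep.1 _ (hmem j).1 (hmem j).2.1 (hmem j).2.2).2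
  · intro j j' hjj
    exact hsep.2 _ _ (hmem j).1 (hmem j').2.1 hjj (hmem j).2.2 (hmem j').2.2

/-- **THE BLOCK-LABEL CHARACTER-SUM BOUND for an `η`-separated block** (pass-set positions): `t ≠ 0` ⟹
`‖Σ_v (−1)^{Q v}·e₃(⟨t, blockLabel L (posOf L ℓ P) v⟩)·e_p(μ·v)‖ ≤ 2^ℓ·exp(−η_p·⌊ℓ/η⌋/4^{s+1})`. -/
theorem norm_twisted_blockLabel_le_of_sepBlock (hp3 : p ≠ 3) {L R : ℕ}
    (y : Fin (L + ℓ + R + 1) → (Fin (L + ℓ + R) → Bool) → Bool) {η : ℕ} (hsep : SepBlock y L ℓ η)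
    (P : Finset (Fin (L + ℓ + R + 1))) (hlive : ∀ g ∈ P, Live y g)
    {s : ℕ} {Q : CubeFn (ZMod 2) ℓ} (hQ : Q ∈ lowDeg (ZMod 2) ℓ s) (μ : Fin ℓ → ZMod p)
    (t : ZMod 3 × (Fin (insideCuts L ℓ P).card → ZMod 3)) (ht : t ≠ 0) :
    ‖∑ v : Fin ℓ → Bool, GowersCube.signChar (Q v) *
        ((ZMod.stdAddChar (labelDot t (blockLabel L (posOf L ℓ P) v)) : ℂ) * ZMod.stdAddChar (linPart μ v))‖ ≤
      2 ^ ℓ * Real.exp (-(etaP p * (ℓ / η : ℕ) / 4 ^ (s + 1))) := by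
  have hs := le_card_labelCoef_support_of_sepBlock y hsep P hlive t ht
  simp_rw [labelDot_blockLabel L (posOf L ℓ P) t]
  exact norm_twisted_label_le_of_support hp3 hQ (labelCoef L (posOf L ℓ P) t) μ hs

end LabelCoef

end Summit.QuantumAdvantage.QuantumAdvantage.Theorems.RankDial
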